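import Summits.QuantumFields.YangMills.Theorems.BalabanUVNodesN15CovariantLaplacianSpecies
import Summits.QuantumFields.YangMills.Theorems.BalabanUVNodesN15FullPropagatorMatrixTwoSidedNode
import HarnessLib

/-!
# THE DRESSED PROPAGATOR OF THE LINEAGE IS A GREEN's FUNCTION: `X(U) = (Δ_a ⊗ 1_ι − V(U))⁻¹` EXACTLY (both one-sided identities, finite carrier), and — for the exact species of FILE 28 —
# `X(e^{iηA}) = (Δ_{U′} + [DRD* + aQ*Q]_{U ≡ 1} ⊗ 1_ι)⁻¹`: BAŁABAN's `Δ_a` (3.26) WITH ITS LAPLACIAN MADE COVARIANT AT `U′ = e^{iηA}`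
# (dag-n15-c g10, FILE 31; Track-A node N15 = NE2, s1 «background-layer OPERATOR ingredient»)

`--kind proof --supports stmt-QuantumFields-20544 --as helper` (K3⁷; count-neutral; theorems only).  Imports BY NAME this seat's FILE 28 `…CovariantLaplacianSpecies` (`speciesOpM`,
`unstackM_comp_stack_eq_speciesOpM_comp`, `covLapM`, `covLapM_one_eq`, `covLapM_gaugeTransport_eq`, `gaugeTransport`, `v1coefCX`, `v1coefAX`) and FILE 21
`…FullPropagatorMatrixTwoSidedNode` (`dPiecesM₂`, `dPiecesM₂_inl` ∕ `_inr`; through it M1 `bgPairM`, `projO_none_bgPairM`, `unstackM`, n15-b B1a∕B1b `bgPropV_fix`, `stack`, `projO`, M4 `tensorId`,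
dag-n15-a parts 34∕39∕46 `symbOp`, `sLap`, `sLapDir`, `sTinv`, `sD`, `gOp`, `deltaOp`, `deltaOp_comp_gOp`, `deltaOp_eq`, `landauRe`, `qvRe`, `qvAdjRe`, FILE 4 `symbOp_sD_eq`); nothing in
the tree is modified.

WHY.  Every `NE2PlusOperator` theorem of this lineage is about the entry operators of M1's dressed pair `X̂(U) = (1 − ĜV̂(U))⁻¹Ĝ` (n15-b B1a `bgPropV`: a NEUMANN-type object, (3.64)).  Referees
(and the honesty ledger) ask what this object IS.  Answer, kernel-checked here: whenever the Neumann inverse exists (`1 − [ĜV̂]` a unit — the hypothesis under which every letter of the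
lineage is derived) and the derived pieces are the genuine quotients of `G`, the dressed propagator `X = pr₀X̂` is THE two-sided inverse of `Δ ⊗ 1_ι − V(U)` for ANY left inverse `Δ`
of `G` (`ΔG = 1`; the right identity by finite dimension) — for the torus family: of `Δ_a ⊗ 1_ι − V(U)` with Bałaban's `Δ_a = Δ − ∂P∂* + aQ*Q` ((1.69) = part 46 `deltaOp_eq`).  With
FILE 28's exact (3.53) this is, for the exact species of a gauge field, the inverse of `Δ_{U′} ⊗⋯ + (−∂P∂* + aQ*Q)(1) ⊗ 1_ι` — the GENUINE covariant (rough) Laplacian at `U′ = e^{iηA}`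
plus the `U ≡ 1` gauge-fixing and averaging terms of (3.26): the precise sense in which the operator layer is «genuine in the Laplacian, `U ≡ 1` in `DRD*` and `Q*aQ`».

WHAT.  §1 (abstract pair space, any lattice `X`, components `ι`, directions `J`): `unstackM_comp_bgPairM_eq` (`V̂∘X̂ = V∘X`), ★★ `sub_species_comp_dressed_eq_id` (`(Δ − V)∘X = 1` from
`ΔG = 1`), ★★ `dressed_comp_sub_species_eq_id` (`X∘(Δ − V) = 1`, finite dimension).  §2 (the torus pieces `G = gOp ⊗ 1_ι`, `dPiecesM₂`, ANY coefficient pair): `tensorId_comp_tensorId`,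
`tensorId_id`, ★★ `deltaOp_sub_species_comp_dressed` ∕ `dressed_comp_deltaOp_sub_species` (`X(C, A) = (Δ_a ⊗ 1_ι − V(C, A))⁻¹`).  §3 THE DICTIONARY `symbOp_sTinv_eq_pull_symm`,
`tensorId_add` ∕ `_neg` ∕ `_smul` ∕ `_sum` ∕ `_sub`, ★ `tensorId_symbOp_sLapDir` ∕ ★ `tensorId_symbOp_sLap` (dag-n15-a's Laplacian symbol `ρ(sLap)` ⊗ 1_ι IS FILE 28's `covLapM` at `R ≡ 1`),
★★★ **`covLap_dressed_inverse`**: for a gauge field `A′` on the torus at spacing `η = n⁻¹` and the exact coefficients `(v1coefCX, v1coefAX)` of FILE 28,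
`[Δ_{e^{ηA′}} + (a·Q*Q − ∂P∂*)(1) ⊗ 1_ι] ∘ X = 1` and `X ∘ [⋯] = 1`.

HONEST FRAMING.  Finite-dimensional linear ALGEBRA over the lineage's own objects (no estimate); the unit hypothesis `hunit` is the Neumann-convergence hypothesis of every letter of the
lineage (discharged there in the (3.35)-window from the letters; displayed here); `U ≡ 1` chart; `DRD*` and `aQ*Q` NOT dressed ((3.55)–(3.68) untouched); `𝔤 ↦ 𝔄`, coordinates `e`;
NE2⁺ NOT PRINTED, not claimed; count-neutral; N15 NOT discharged; one finite torus at fixed ε — NOT ℝ⁴, NOT infinite volume, NOT OS, NOT a mass gap, NOT Clay.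
-/

noncomputable section

open scoped BigOperators
open Finset

namespace Summit.QuantumFields.YangMills.BalabanUVNodes.N15.BackgroundLayer

open Literature.MathematicalPhysics.QuantumFieldTheory.Balaban1983to89
open Literature.MathematicalPhysics.QuantumFieldTheory.Balaban1983to89.T4EtaRateCoeffDefect (pull pull_apply)
open Literature.MathematicalPhysics.QuantumFieldTheory.Balaban1983to89.B5Prop11Plancherel (Tor fine unitVec)
open Summit.QuantumFields.YangMills.BalabanUVNodes.N15.MatrixSpecies (mmulOp liftMap liftEquiv liftEquiv_apply liftEquiv_symm_apply)
open Summit.QuantumFields.YangMills.BalabanUVNodes.N15.TwoGrid (gOp deltaOp symbOp sLap sLapDir sT sTinv sD landauRe qvRe qvAdjRe deltaOp_eq deltaOp_comp_gOp symbOp_single_apply)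
open Summit.QuantumFields.YangMills.BalabanUVNodes.N15.VectorPiece (bshiftEquiv bshiftEquiv_apply bshiftEquiv_symm_apply tensorId tensorId_apply)

/-! ## §1 The dressed propagator inverts `Δ − V` (abstract pair space) -/

section Abstract

variable {X J ι : Type} [Fintype X] [Fintype J] [Fintype ι] [DecidableEq X] [DecidableEq J] [DecidableEq ι] (τ : J → X ≃ X) (n : ℝ)
  (G : (X × ι → ℝ) →ₗ[ℝ] (X × ι → ℝ)) {D : J ⊕ J → (X × ι → ℝ) →ₗ[ℝ] (X × ι → ℝ)} (C : X → Matrix ι ι ℝ) (A : J ⊕ J → X → Matrix ι ι ℝ)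

/-- `V̂∘X̂ = V∘X`: the unstacked perturbation of M1's dressed pair is the species operator applied to the dressed propagator `X = pr₀X̂` (derived pieces = quotients of `G`, Neumann
inverse a unit). [cite: Balaban1985BackgroundPropagators, (3.64)–(3.65) p.402 (mechanism)] -/
theorem unstackM_comp_bgPairM_eq (hDf : ∀ μ, D (Sum.inl μ) = fgrad n (liftEquiv (τ μ) ι) ∘ₗ G) (hDb : ∀ μ, D (Sum.inr μ) = bgrad n (liftEquiv (τ μ) ι) ∘ₗ G)
    (hunit : IsUnit (1 - LinearMap.toMatrix' (stack G D ∘ₗ unstackM C A))) :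
    unstackM C A ∘ₗ bgPairM G D C A = speciesOpM τ n C A ∘ₗ (projO none ∘ₗ bgPairM G D C A) := by
  have hfix : bgPairM G D C A = stack G D + (stack G D ∘ₗ unstackM C A) ∘ₗ bgPairM G D C A := bgPropV_fix hunit
  have hV := unstackM_comp_stack_eq_speciesOpM_comp τ n G C A hDf hDb
  calc unstackM C A ∘ₗ bgPairM G D C A
      = unstackM C A ∘ₗ (stack G D + (stack G D ∘ₗ unstackM C A) ∘ₗ bgPairM G D C A) := by rw [← hfix]
    _ = (unstackM C A ∘ₗ stack G D) ∘ₗ (LinearMap.id + unstackM C A ∘ₗ bgPairM G D C A) := by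
        simp only [LinearMap.comp_add, LinearMap.comp_id, LinearMap.comp_assoc]
    _ = speciesOpM τ n C A ∘ₗ (G + G ∘ₗ (unstackM C A ∘ₗ bgPairM G D C A)) := by
        rw [hV, LinearMap.comp_assoc, LinearMap.comp_add, LinearMap.comp_id]
    _ = speciesOpM τ n C A ∘ₗ (projO none ∘ₗ bgPairM G D C A) := by rw [projO_none_bgPairM hunit]

/-- ★★ **`(Δ − V)∘X = 1`**: for ANY left inverse `Δ` of the `U ≡ 1` piece (`Δ∘G = 1`), the dressed propagator `X = pr₀X̂` is a right inverse of `Δ − V` — from `X = G + G∘V∘X` ((3.65),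
M1 `projO_none_bgPairM` + `unstackM_comp_bgPairM_eq`). [cite: Balaban1985BackgroundPropagators, (3.62)–(3.65) p.402] -/
theorem sub_species_comp_dressed_eq_id (Δ : (X × ι → ℝ) →ₗ[ℝ] (X × ι → ℝ)) (hΔ : Δ ∘ₗ G = LinearMap.id)
    (hDf : ∀ μ, D (Sum.inl μ) = fgrad n (liftEquiv (τ μ) ι) ∘ₗ G) (hDb : ∀ μ, D (Sum.inr μ) = bgrad n (liftEquiv (τ μ) ι) ∘ₗ G)
    (hunit : IsUnit (1 - LinearMap.toMatrix' (stack G D ∘ₗ unstackM C A))) :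
    (Δ - speciesOpM τ n C A) ∘ₗ (projO none ∘ₗ bgPairM G D C A) = LinearMap.id := by
  have hX : projO none ∘ₗ bgPairM G D C A = G + G ∘ₗ (speciesOpM τ n C A ∘ₗ (projO none ∘ₗ bgPairM G D C A)) := by
    conv_lhs => rw [projO_none_bgPairM hunit, unstackM_comp_bgPairM_eq τ n G C A hDf hDb hunit]
  rw [LinearMap.sub_comp]
  conv_lhs => rw [hX]
  rw [LinearMap.comp_add, ← LinearMap.comp_assoc, hΔ, LinearMap.id_comp, ← hX]
  abel

/-- ★★ **`X∘(Δ − V) = 1`**: the right inverse is a left inverse — the carrier `X × ι → ℝ` is finite-dimensional (`LinearMap.mul_eq_one_comm`). [folklore] -/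
theorem dressed_comp_sub_species_eq_id (Δ : (X × ι → ℝ) →ₗ[ℝ] (X × ι → ℝ)) (hΔ : Δ ∘ₗ G = LinearMap.id)
    (hDf : ∀ μ, D (Sum.inl μ) = fgrad n (liftEquiv (τ μ) ι) ∘ₗ G) (hDb : ∀ μ, D (Sum.inr μ) = bgrad n (liftEquiv (τ μ) ι) ∘ₗ G)
    (hunit : IsUnit (1 - LinearMap.toMatrix' (stack G D ∘ₗ unstackM C A))) :
    (projO none ∘ₗ bgPairM G D C A) ∘ₗ (Δ - speciesOpM τ n C A) = LinearMap.id := by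
  have h : (Δ - speciesOpM τ n C A) * (projO none ∘ₗ bgPairM G D C A) = 1 := sub_species_comp_dressed_eq_id τ n G C A Δ hΔ hDf hDb hunit
  exact mul_eq_one_comm.mp h

end Abstract

/-! ## §2 The torus pieces: `X(C, A) = (Δ_a ⊗ 1_ι − V(C, A))⁻¹` -/

section Torus

variable {d : ℕ} (ι : Type) [Fintype ι] [DecidableEq ι]

omit [Fintype ι] [DecidableEq ι] in
/-- `(S ⊗ 1)∘(T ⊗ 1) = (S∘T) ⊗ 1` (g6 E1's `tensorId_comp`, restated rfl here to keep the import set small). [folklore] -/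
theorem tensorId_comp_tensorId {X X₂ X₃ : Type} (S : (X₂ → ℝ) →ₗ[ℝ] (X₃ → ℝ)) (T : (X → ℝ) →ₗ[ℝ] (X₂ → ℝ)) :
    tensorId ι S ∘ₗ tensorId ι T = tensorId ι (S ∘ₗ T) :=
  LinearMap.ext fun _ => funext fun _ => rfl

omit [Fintype ι] [DecidableEq ι] in
/-- `1 ⊗ 1 = 1`. [folklore] -/
theorem tensorId_id {X : Type} : tensorId ι (LinearMap.id : (X → ℝ) →ₗ[ℝ] (X → ℝ)) = LinearMap.id :=
  LinearMap.ext fun _ => funext fun _ => rfl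

variable (d) (M : Fin (d + 1) → ℕ) [∀ μ, NeZero (M μ)] (n : ℕ) [NeZero n]

/-- ★★ **`(Δ_a ⊗ 1_ι − V(C, A))∘X(C, A) = 1` ON THE TORUS**: for Bałaban's `G = Δ_a⁻¹` (part 39 `gOp`, `deltaOp_comp_gOp`) lifted to `𝔤 ≅ ℝ^ι`-valued 1-forms, the two-sided derived pieces
`dPiecesM₂` and ANY coefficient pair `(C, A)` whose Neumann inverse exists. [cite: Balaban1984PropagatorsI, (1.71) p.30; Balaban1985BackgroundPropagators, (3.62)–(3.65) p.402] -/
theorem deltaOp_sub_species_comp_dressed (hn : 1 ≤ n) {b : ℝ} (hb : 0 < b) (C : Tor (fine n M) × Fin (d + 1) → Matrix ι ι ℝ)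
    (A : Fin (d + 1) ⊕ Fin (d + 1) → Tor (fine n M) × Fin (d + 1) → Matrix ι ι ℝ)
    (hunit : IsUnit (1 - LinearMap.toMatrix' (stack (tensorId ι (gOp M n b)) (dPiecesM₂ d ι M n b) ∘ₗ unstackM C A))) :
    (tensorId ι (deltaOp M n b) - speciesOpM (bshiftEquiv M n) (n : ℝ) C A) ∘ₗ (projO none ∘ₗ bgPairM (tensorId ι (gOp M n b)) (dPiecesM₂ d ι M n b) C A) =
      LinearMap.id :=
  sub_species_comp_dressed_eq_id (bshiftEquiv M n) (n : ℝ) (tensorId ι (gOp M n b)) C A (tensorId ι (deltaOp M n b))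
    (by rw [tensorId_comp_tensorId, deltaOp_comp_gOp M n b hn hb, tensorId_id]) (dPiecesM₂_inl d ι M n b) (dPiecesM₂_inr d ι M n b) hunit

/-- ★★ **`X(C, A)∘(Δ_a ⊗ 1_ι − V(C, A)) = 1` ON THE TORUS.** [cite: Balaban1984PropagatorsI, (1.71) p.30; Balaban1985BackgroundPropagators, (3.62)–(3.65) p.402] -/
theorem dressed_comp_deltaOp_sub_species (hn : 1 ≤ n) {b : ℝ} (hb : 0 < b) (C : Tor (fine n M) × Fin (d + 1) → Matrix ι ι ℝ)
    (A : Fin (d + 1) ⊕ Fin (d + 1) → Tor (fine n M) × Fin (d + 1) → Matrix ι ι ℝ)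
    (hunit : IsUnit (1 - LinearMap.toMatrix' (stack (tensorId ι (gOp M n b)) (dPiecesM₂ d ι M n b) ∘ₗ unstackM C A))) :
    (projO none ∘ₗ bgPairM (tensorId ι (gOp M n b)) (dPiecesM₂ d ι M n b) C A) ∘ₗ (tensorId ι (deltaOp M n b) - speciesOpM (bshiftEquiv M n) (n : ℝ) C A) =
      LinearMap.id :=
  dressed_comp_sub_species_eq_id (bshiftEquiv M n) (n : ℝ) (tensorId ι (gOp M n b)) C A (tensorId ι (deltaOp M n b))
    (by rw [tensorId_comp_tensorId, deltaOp_comp_gOp M n b hn hb, tensorId_id]) (dPiecesM₂_inl d ι M n b) (dPiecesM₂_inr d ι M n b) hunit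

end Torus

/-! ## §3 The dictionary `ρ(sLap) ⊗ 1 = Δ_1` and the covariant form of the inverse -/

section Dictionary

variable {d : ℕ} (ι : Type) [Fintype ι] [DecidableEq ι]

omit [Fintype ι] [DecidableEq ι] in
/-- `tensorId` is additive. [folklore] -/
theorem tensorId_add {X X₂ : Type} (S T : (X → ℝ) →ₗ[ℝ] (X₂ → ℝ)) : tensorId ι (S + T) = tensorId ι S + tensorId ι T :=
  LinearMap.ext fun _ => funext fun _ => rfl

omit [Fintype ι] [DecidableEq ι] in
/-- `tensorId` commutes with negation. [folklore] -/
theorem tensorId_neg {X X₂ : Type} (T : (X → ℝ) →ₗ[ℝ] (X₂ → ℝ)) : tensorId ι (-T) = -tensorId ι T :=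
  LinearMap.ext fun _ => funext fun _ => rfl

omit [Fintype ι] [DecidableEq ι] in
/-- `tensorId` commutes with subtraction. [folklore] -/
theorem tensorId_sub {X X₂ : Type} (S T : (X → ℝ) →ₗ[ℝ] (X₂ → ℝ)) : tensorId ι (S - T) = tensorId ι S - tensorId ι T :=
  LinearMap.ext fun _ => funext fun _ => rfl

omit [Fintype ι] [DecidableEq ι] in
/-- `tensorId` is homogeneous. [folklore] -/
theorem tensorId_smul {X X₂ : Type} (c : ℝ) (T : (X → ℝ) →ₗ[ℝ] (X₂ → ℝ)) : tensorId ι (c • T) = c • tensorId ι T :=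
  LinearMap.ext fun _ => funext fun _ => rfl

omit [Fintype ι] [DecidableEq ι] in
/-- `tensorId` of a finite sum. [folklore] -/
theorem tensorId_sum {X X₂ K : Type} [Fintype K] (T : K → (X → ℝ) →ₗ[ℝ] (X₂ → ℝ)) : tensorId ι (∑ k, T k) = ∑ k, tensorId ι (T k) := by
  have hz : tensorId ι (0 : (X → ℝ) →ₗ[ℝ] (X₂ → ℝ)) = 0 := LinearMap.ext fun _ => funext fun _ => rfl
  let φ : ((X → ℝ) →ₗ[ℝ] (X₂ → ℝ)) →+ ((X × ι → ℝ) →ₗ[ℝ] (X₂ × ι → ℝ)) := { toFun := tensorId ι, map_zero' := hz, map_add' := tensorId_add ι }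
  exact map_sum φ T Finset.univ

variable (M : Fin (d + 1) → ℕ) [∀ μ, NeZero (M μ)] (n : ℕ) [NeZero n]

omit [Fintype ι] [DecidableEq ι] [∀ μ, NeZero (M μ)] [NeZero n] in
/-- `ρ(s_ν⁻¹) = pull e_ν⁻¹` (the backward translation). [folklore] -/
theorem symbOp_sTinv_eq_pull_symm (ν : Fin (d + 1)) : symbOp M n (sTinv M n ν) = pull ⇑(bshiftEquiv M n ν).symm := by
  refine LinearMap.ext fun f => funext fun i => ?_
  rw [sTinv, symbOp_single_apply, one_mul, pull_apply, bshiftEquiv_symm_apply, ← sub_eq_add_neg]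

omit [Fintype ι] [DecidableEq ι] [∀ μ, NeZero (M μ)] [NeZero n] in
/-- ★ ONE DIRECTION: `ρ(sLapDir_ν(n)) ⊗ 1_ι = n(∇⁻_ν − ∇⁺_ν)` on the product carrier (`sLapDir_ν = −s_ν⁻¹(n(s_ν − 1))²`; FILE 4 `symbOp_sD_eq`). [cite: Balaban1984PropagatorsI, (1.69) p.29 (Δ = Σ_ν ∇_ν*∇_ν: shape)] -/
theorem tensorId_symbOp_sLapDir (ν : Fin (d + 1)) :
    tensorId ι (symbOp M n (sLapDir M n ν (n : ℝ))) =
      (n : ℝ) • (bgrad (n : ℝ) (liftEquiv (bshiftEquiv M n ν) ι) - fgrad (n : ℝ) (liftEquiv (bshiftEquiv M n ν) ι)) := by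
  rw [sLapDir, map_neg, map_mul, map_pow, symbOp_sD_eq, symbOp_sTinv_eq_pull_symm]
  refine LinearMap.ext fun f => funext fun p => ?_
  simp only [tensorId_apply, LinearMap.neg_apply, Pi.neg_apply, Module.End.mul_apply, pow_two, pull_apply, fgrad_apply, LinearMap.smul_apply, LinearMap.sub_apply,
    Pi.smul_apply, Pi.sub_apply, bgrad_apply, liftEquiv_apply, liftEquiv_symm_apply, bshiftEquiv_apply, bshiftEquiv_symm_apply, smul_eq_mul, sub_add_cancel]
  ring

omit [∀ μ, NeZero (M μ)] [NeZero n] in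
/-- ★ **THE DICTIONARY**: dag-n15-a's Laplacian `ρ(sLap(n))` (the `Δ` of `Δ_a = Δ − ∂P∂* + aQ*Q`, part 46 `deltaOp_eq`) lifted to `𝔤 ≅ ℝ^ι`-valued 1-forms IS FILE 28's covariant Laplacian
at the trivial transports, `covLapM τ η 1` with `τ = bshiftEquiv`, `η = n⁻¹`. [cite: Balaban1984PropagatorsI, (1.69) p.29; Balaban1985BackgroundPropagators, (3.50) p.400 (at U ≡ 1)] -/
theorem tensorId_symbOp_sLap :
    tensorId ι (symbOp M n (sLap M n (n : ℝ))) = covLapM (ι := ι) (bshiftEquiv M n) ((n : ℝ)⁻¹) (fun _ _ => 1) := by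
  rw [covLapM_one_eq, inv_inv, sLap, map_sum, tensorId_sum, Finset.smul_sum]
  exact Finset.sum_congr rfl fun ν _ => tensorId_symbOp_sLapDir ι M n ν

variable {𝔄 : Type} [NormedRing 𝔄] [NormedAlgebra ℝ 𝔄] (e : 𝔄 ≃L[ℝ] (ι → ℝ))

/-- ★★★ **THE DRESSED PROPAGATOR OF THE EXACT SPECIES IS THE GREEN's FUNCTION OF BAŁABAN's `Δ_a` WITH ITS LAPLACIAN MADE COVARIANT.**  For a gauge field `A′` on the torus
`T_{2L^m}` at spacing `η = n⁻¹` (`n ≥ 1`, `a > 0`), the exact coefficients `(c, a) = (v1coefCX, v1coefAX)(A′)` of FILE 28 and the dressed propagator `X = pr₀ X̂(c, a)` built on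
`G = Δ_a⁻¹ ⊗ 1_ι` and its two-sided quotients, whenever the Neumann inverse exists:
`[Δ_{e^{ηA′}} + (a·Q*Q − ∂P∂*)_{U ≡ 1} ⊗ 1_ι] ∘ X = 1` and `X ∘ [⋯] = 1`, where `Δ_{e^{ηA′}} = covLapM τ η (gaugeTransport e τ η A′)` is Bałaban's covariant Laplacian (3.50) of the transports
`exp(±η ad A′)` — i.e. `X` inverts (3.26)'s `Δ_a(U′) = Δ(U′) + DR D* + Q*aQ` with `DRD*` and `Q*aQ` kept at `U ≡ 1` (parts 46∕45 `landauRe`, `qvAdjRe ∘ qvRe`).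
[cite: Balaban1985BackgroundPropagators, (3.26) p.395, (3.50)–(3.53) p.400, (3.62)–(3.65) p.402; Balaban1984PropagatorsI, (1.69)–(1.71) pp.29–30] -/
theorem covLap_dressed_inverse (hn : 1 ≤ n) {b : ℝ} (hb : 0 < b) (A' : Fin (d + 1) → Tor (fine n M) × Fin (d + 1) → 𝔄)
    (hunit : IsUnit (1 - LinearMap.toMatrix' (stack (tensorId ι (gOp M n b)) (dPiecesM₂ d ι M n b) ∘ₗ
      unstackM (v1coefCX e ((n : ℝ)⁻¹) (v1fieldsOfGauge 𝔄 (Fin (d + 1)) (bshiftEquiv M n) ((n : ℝ)⁻¹) A'))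
        (v1coefAX e ((n : ℝ)⁻¹) (v1fieldsOfGauge 𝔄 (Fin (d + 1)) (bshiftEquiv M n) ((n : ℝ)⁻¹) A'))))) :
    (covLapM (bshiftEquiv M n) ((n : ℝ)⁻¹) (gaugeTransport e (bshiftEquiv M n) ((n : ℝ)⁻¹) A') + tensorId ι (b • (qvAdjRe M n ∘ₗ qvRe M n) - landauRe M n)) ∘ₗ
        (projO none ∘ₗ bgPairM (tensorId ι (gOp M n b)) (dPiecesM₂ d ι M n b)
          (v1coefCX e ((n : ℝ)⁻¹) (v1fieldsOfGauge 𝔄 (Fin (d + 1)) (bshiftEquiv M n) ((n : ℝ)⁻¹) A'))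
          (v1coefAX e ((n : ℝ)⁻¹) (v1fieldsOfGauge 𝔄 (Fin (d + 1)) (bshiftEquiv M n) ((n : ℝ)⁻¹) A'))) = LinearMap.id ∧
      (projO none ∘ₗ bgPairM (tensorId ι (gOp M n b)) (dPiecesM₂ d ι M n b)
          (v1coefCX e ((n : ℝ)⁻¹) (v1fieldsOfGauge 𝔄 (Fin (d + 1)) (bshiftEquiv M n) ((n : ℝ)⁻¹) A'))
          (v1coefAX e ((n : ℝ)⁻¹) (v1fieldsOfGauge 𝔄 (Fin (d + 1)) (bshiftEquiv M n) ((n : ℝ)⁻¹) A'))) ∘ₗ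
        (covLapM (bshiftEquiv M n) ((n : ℝ)⁻¹) (gaugeTransport e (bshiftEquiv M n) ((n : ℝ)⁻¹) A') + tensorId ι (b • (qvAdjRe M n ∘ₗ qvRe M n) - landauRe M n)) =
        LinearMap.id := by
  have hn0 : ((n : ℝ))⁻¹ ≠ 0 := inv_ne_zero (Nat.cast_ne_zero.mpr (by omega))
  have key : covLapM (bshiftEquiv M n) ((n : ℝ)⁻¹) (gaugeTransport e (bshiftEquiv M n) ((n : ℝ)⁻¹) A') + tensorId ι (b • (qvAdjRe M n ∘ₗ qvRe M n) - landauRe M n) =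
      tensorId ι (deltaOp M n b) - speciesOpM (bshiftEquiv M n) (n : ℝ)
        (v1coefCX e ((n : ℝ)⁻¹) (v1fieldsOfGauge 𝔄 (Fin (d + 1)) (bshiftEquiv M n) ((n : ℝ)⁻¹) A'))
        (v1coefAX e ((n : ℝ)⁻¹) (v1fieldsOfGauge 𝔄 (Fin (d + 1)) (bshiftEquiv M n) ((n : ℝ)⁻¹) A')) := by
    rw [covLapM_gaugeTransport_eq e hn0, inv_inv, ← tensorId_symbOp_sLap, deltaOp_eq, tensorId_add, tensorId_sub, tensorId_sub]
    abel
  rw [key]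
  exact ⟨deltaOp_sub_species_comp_dressed d ι M n hn hb _ _ hunit, dressed_comp_deltaOp_sub_species d ι M n hn hb _ _ hunit⟩

end Dictionary

end Summit.QuantumFields.YangMills.BalabanUVNodes.N15.BackgroundLayer

end
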